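import Summits.CriticalPhenomena.Ising3DConformalLimit.Theses.PerfectScreening
import Literature.Probability.LatticeModels.LatticeGreenPoisson
import Literature.Probability.LatticeModels.LatticeGreenFunction
import Literature.Probability.LatticeModels.TwoPointSupNormMonotone
import Literature.Probability.LatticeModels.CriticalTwoPointBounds
import Literature.Probability.LatticeModels.CriticalTwoPointLawDimension

/-!
# Perfect screening from non-saturation (route `PerfectScreening`, item `ScreeningUpgrade`)

Route `PerfectScreening` of `CriticalPhenomena / Ising3DConformalLimit`, support item
`stmt-CriticalPhenomena-1346` (`ScreeningUpgrade`): with `G := ⟨σ₀σ_x⟩⁺_{β_c(3)} = criticalTwoPoint 3`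
and `G₀` the Green function of the graph Laplacian of `ℤ³` (the inline Brillouin-zone integral of
the route file, `= latticeGreen / 2` by `setIntegral_pi_cos_div_eq_half_latticeGreen`),

  `GreenAsymptotics → SubH → NonSat → ‖x‖ · G(x) → 0` along the cofinite filter of `ℤ³`,

i.e. the upgrade "`liminf_n n·G(n e₁) = 0` ⇒ `lim_{|x|→∞} ‖x‖ G(x) = 0`" under lattice
subharmonicity of `G` off the origin.

## Proof (exterior maximum principle; no Riesz decomposition is needed)

Fix `ε > 0` and put `ε' := ε/16`, `λ := 4ε'/a` (`a > 0` the Coulomb constant of `G₀`,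
`|G₀(x) - a/|x|₂| ≤ K/|x|₂²`, whence `a/(4‖x‖) ≤ G₀(x) ≤ 2a/‖x‖` once `‖x‖ ≥ 2K/a`, `‖·‖` the
sup norm). By `NonSat` there is an arbitrarily large `n` with `n · G(n e₁) < ε'`; by the
Messager–Miracle-Solé comparison (`twoPointPlus_le_axis_of_mem_sphere`: the maximum of `G` on the
sup-norm sphere `‖y‖ = n` is attained on the axis) `G ≤ ε'/n ≤ λ G₀` on that sphere. On the
exterior `{‖x‖ > n}` the function `G - λG₀` is subharmonic (`SubH` and the lattice Poisson identity
`Δ G₀ = -δ₀`, `latticeLaplacianZd_half_latticeGreen`), it is `≤ 0` on the sphere and tends to `0`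
at infinity (`criticalTwoPoint_tendsto_zero_cofinite`, `tendsto_latticeGreen_cofinite`); the maximum
principle at infinity (`IsZdSubharmonicOn.le_of_tendsto`, applied to the function cut off to `0`
inside the box) gives `G ≤ λ G₀ ≤ 8ε'/‖x‖ = ε/(2‖x‖)` for all `‖x‖ ≥ n`. Hence `‖x‖ G(x) < ε` off
the finite box `Λ_n`, for every `ε > 0`.

References: G. F. Lawler, *Intersections of Random Walks* (1991), §1.4–1.5 (maximum principle,
`ΔG₀ = -δ₀`); G. F. Lawler, V. Limic, *Random Walk: A Modern Introduction* (2010), §4.3, §6.1–6.2;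
A. Messager, S. Miracle-Solé, J. Stat. Phys. 17 (1977) 245–262.
-/

noncomputable section

namespace Summit.CriticalPhenomena.Ising3DConformalLimit.Theorems

open Filter Topology Finset
open Literature.Probability.LatticeModels

/-! ### Sup-norm geometry of `ℤ^d` -/

/-- A forward neighbour loses at most one unit of sup norm: `‖x‖_∞ ≤ ‖x + eᵢ‖_∞ + 1`. [folklore] -/
theorem supNorm_le_supNorm_add_single_succ {d : ℕ} (x : Site d) (i : Fin d) :
    Site.supNorm x ≤ Site.supNorm (x + Pi.single i 1) + 1 :=
  Site.supNorm_le_succ_of_adj ((zdGraph_adj_iff _ _).2 ⟨i, Or.inr rfl⟩)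

/-- A backward neighbour loses at most one unit of sup norm: `‖x‖_∞ ≤ ‖x - eᵢ‖_∞ + 1`. [folklore] -/
theorem supNorm_le_supNorm_sub_single_succ {d : ℕ} (x : Site d) (i : Fin d) :
    Site.supNorm x ≤ Site.supNorm (x - Pi.single i 1) + 1 :=
  Site.supNorm_le_succ_of_adj ((zdGraph_adj_iff _ _).2 ⟨i, Or.inl (sub_add_cancel _ _).symm⟩)

/-- A nonzero site has sup norm at least one. [folklore] -/
theorem one_le_supNorm_of_ne_zero {d : ℕ} {x : Site d} (hx : x ≠ 0) : 1 ≤ Site.supNorm x := by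
  by_contra h
  exact hx (Site.supNorm_eq_zero_iff.1 (by omega))

/-- Each real coordinate is bounded by the sup norm: `|xᵢ| ≤ ‖x‖_∞`. [folklore] -/
theorem abs_intCast_apply_le_supNorm {d : ℕ} (x : Site d) (i : Fin d) :
    |((x i : ℤ) : ℝ)| ≤ (Site.supNorm x : ℝ) := by
  have h : (((x i).natAbs : ℕ) : ℝ) = |((x i : ℤ) : ℝ)| := by rw [Nat.cast_natAbs, Int.cast_abs]
  rw [← h]
  exact_mod_cast Site.natAbs_le_supNorm x i

/-- **Sup norm versus Euclidean norm on `ℤ³`, lower half**: `‖x‖_∞² ≤ ∑ᵢ xᵢ²`. [folklore] -/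
theorem supNorm_sq_le_sum_sq (x : Site 3) :
    (Site.supNorm x : ℝ) ^ 2 ≤ ∑ i, ((x i : ℤ) : ℝ) ^ 2 := by
  obtain ⟨i₀, hi₀⟩ := Site.exists_natAbs_eq_supNorm Finset.univ_nonempty x
  have h1 : (Site.supNorm x : ℝ) ^ 2 = ((x i₀ : ℤ) : ℝ) ^ 2 := by
    rw [← hi₀, Nat.cast_natAbs, Int.cast_abs, sq_abs]
  rw [h1]
  exact Finset.single_le_sum (f := fun i => ((x i : ℤ) : ℝ) ^ 2) (fun j _ => sq_nonneg _)
    (mem_univ i₀)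

/-- **Sup norm versus Euclidean norm on `ℤ³`, upper half**: `∑ᵢ xᵢ² ≤ 3 ‖x‖_∞²`. [folklore] -/
theorem sum_sq_le_three_mul_supNorm_sq (x : Site 3) :
    ∑ i, ((x i : ℤ) : ℝ) ^ 2 ≤ 3 * (Site.supNorm x : ℝ) ^ 2 := by
  calc ∑ i, ((x i : ℤ) : ℝ) ^ 2 ≤ ∑ _i : Fin 3, (Site.supNorm x : ℝ) ^ 2 :=
        Finset.sum_le_sum fun i _ => by
          rw [← sq_abs]
          exact pow_le_pow_left₀ (abs_nonneg _) (abs_intCast_apply_le_supNorm x i) 2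
    _ = 3 * (Site.supNorm x : ℝ) ^ 2 := by simp

/-- `‖x‖_∞ ≤ |x|₂` on `ℤ³`. [folklore] -/
theorem supNorm_le_sqrt_sum_sq (x : Site 3) :
    (Site.supNorm x : ℝ) ≤ Real.sqrt (∑ i, ((x i : ℤ) : ℝ) ^ 2) :=
  Real.le_sqrt_of_sq_le (supNorm_sq_le_sum_sq x)

/-- `|x|₂ ≤ 2 ‖x‖_∞` on `ℤ³` (indeed `≤ √3 ‖x‖_∞`). [folklore] -/
theorem sqrt_sum_sq_le_two_mul_supNorm (x : Site 3) :
    Real.sqrt (∑ i, ((x i : ℤ) : ℝ) ^ 2) ≤ 2 * (Site.supNorm x : ℝ) := by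
  rw [Real.sqrt_le_iff]
  refine ⟨by positivity, ?_⟩
  have := sum_sq_le_three_mul_supNorm_sq x
  nlinarith [sq_nonneg (Site.supNorm x : ℝ)]

/-! ### Two-sided Coulomb bounds for the Green function from its asymptotics -/

/-- **Coulomb window from the Green asymptotics.** If `|G₀(x) - a/|x|₂| ≤ K/|x|₂²` for `x ≠ 0`
with `a > 0`, then for every `x ≠ 0` with `‖x‖_∞ ≥ 2 max(K,0)/a` one has
`a/(4‖x‖_∞) ≤ G₀(x) ≤ 2a/‖x‖_∞` (`‖x‖_∞ ≤ |x|₂ ≤ 2‖x‖_∞`). [folklore] -/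
theorem green_window_of_asymptotics {G₀ : Site 3 → ℝ} {a K : ℝ} (ha : 0 < a)
    (hGA : ∀ x : Site 3, x ≠ 0 →
      |G₀ x - a / Real.sqrt (∑ i, ((x i : ℤ) : ℝ) ^ 2)| ≤ K / (∑ i, ((x i : ℤ) : ℝ) ^ 2))
    {x : Site 3} (hx : x ≠ 0) (hR : 2 * max K 0 / a ≤ (Site.supNorm x : ℝ)) :
    a / (4 * (Site.supNorm x : ℝ)) ≤ G₀ x ∧ G₀ x ≤ 2 * a / (Site.supNorm x : ℝ) := by
  set N : ℝ := (Site.supNorm x : ℝ) with hN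
  set S : ℝ := ∑ i, ((x i : ℤ) : ℝ) ^ 2 with hS
  set r : ℝ := Real.sqrt S with hr
  have hN1 : (1 : ℝ) ≤ N := by
    rw [hN]; exact_mod_cast one_le_supNorm_of_ne_zero hx
  have hN0 : 0 < N := by linarith
  have hNr : N ≤ r := supNorm_le_sqrt_sum_sq x
  have hrN : r ≤ 2 * N := sqrt_sum_sq_le_two_mul_supNorm x
  have hr0 : 0 < r := lt_of_lt_of_le hN0 hNr
  have hS0 : 0 < S := by
    have : N ^ 2 ≤ S := supNorm_sq_le_sum_sq x
    nlinarith
  have hrS : r * r = S := Real.mul_self_sqrt hS0.le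
  have hK' : 0 ≤ max K 0 := le_max_right _ _
  -- the error term: `K/S ≤ max(K,0)/S ≤ (a/2)/r`
  have hKr : max K 0 ≤ a / 2 * r := by
    have h1 : 2 * max K 0 / a ≤ r := hR.trans hNr
    rw [div_le_iff₀ ha] at h1
    nlinarith
  have herr : K / S ≤ a / 2 / r := by
    calc K / S ≤ max K 0 / S := div_le_div_of_nonneg_right (le_max_left _ _) hS0.le
      _ = max K 0 / r / r := by rw [← hrS, div_div]
      _ ≤ a / 2 * r / r / r := by gcongr
      _ = a / 2 / r := by rw [mul_div_assoc, div_self hr0.ne', mul_one]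
  have habs := (abs_le.1 ((hGA x hx).trans herr))
  constructor
  · -- lower bound: `G₀ x ≥ a/r - (a/2)/r = (a/2)/r ≥ (a/2)/(2N)`
    have h1 : a / 2 / r ≤ G₀ x := by
      have : a / r - a / 2 / r = a / 2 / r := by ring
      linarith [habs.1]
    calc a / (4 * N) = a / 2 / (2 * N) := by ring
      _ ≤ a / 2 / r := div_le_div_of_nonneg_left (by positivity) hr0 hrN
      _ ≤ G₀ x := h1
  · -- upper bound: `G₀ x ≤ a/r + (a/2)/r ≤ (3a/2)/N ≤ 2a/N`
    have h1 : G₀ x ≤ 3 * a / 2 / r := by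
      have : a / r + a / 2 / r = 3 * a / 2 / r := by ring
      linarith [habs.2]
    calc G₀ x ≤ 3 * a / 2 / r := h1
      _ ≤ 3 * a / 2 / N := div_le_div_of_nonneg_left (by positivity) hN0 hNr
      _ ≤ 2 * a / N := by
        rw [div_le_div_iff_of_pos_right hN0]
        linarith

/-! ### The exterior comparison principle -/

/-- **Exterior comparison principle on `ℤ^d`** (`d ≥ 1`). Let `u` be subharmonic and `v`
superharmonic on the exterior `{‖x‖_∞ > n}` of the box `Λ_n`, `u ≤ v` on the sphere `‖y‖_∞ = n`,
and `u, v → 0` at infinity. Then `u ≤ v` on `{‖x‖_∞ ≥ n}`. (Maximum principle at infinity,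
`IsZdSubharmonicOn.le_of_tendsto`, applied to the difference `u - v` cut off to `0` inside the
box; Lawler 1991, §1.4, Exercise 1.4.7 in the unbounded form of Lawler–Limic 2010, §6.1–6.2.)
[folklore] -/
theorem le_on_exterior_of_le_on_sphere {d : ℕ} (hd : 0 < d) {u v : Site d → ℝ} {n : ℕ}
    (hu : ∀ x, n < Site.supNorm x → 0 ≤ latticeLaplacianZd u x)
    (hv : ∀ x, n < Site.supNorm x → latticeLaplacianZd v x ≤ 0)
    (hbd : ∀ y, Site.supNorm y = n → u y ≤ v y)
    (hu0 : Tendsto u cofinite (𝓝 0)) (hv0 : Tendsto v cofinite (𝓝 0)) :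
    ∀ x, n ≤ Site.supNorm x → u x ≤ v x := by
  classical
  -- the cut-off difference `w = (u - v) · 1_{‖x‖ ≥ n}`
  set w : Site d → ℝ := fun x => if n ≤ Site.supNorm x then u x - v x else 0 with hw
  have hw_eq : ∀ x, n ≤ Site.supNorm x → w x = u x - v x := fun x hx => if_pos hx
  -- `w` is subharmonic on the exterior (locality of `Δ`: all neighbours have `‖·‖ ≥ n`)
  have hsub : IsZdSubharmonicOn w {x | n < Site.supNorm x} := by
    intro x hx
    simp only [Set.mem_setOf_eq] at hx
    have hcongr : latticeLaplacianZd w x = latticeLaplacianZd (u - v) x := by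
      refine latticeLaplacianZd_congr ?_ (fun i => ?_) (fun i => ?_)
      · rw [hw_eq x hx.le, Pi.sub_apply]
      · have := supNorm_le_supNorm_add_single_succ x i
        rw [hw_eq _ (by omega), Pi.sub_apply]
      · have := supNorm_le_supNorm_sub_single_succ x i
        rw [hw_eq _ (by omega), Pi.sub_apply]
    rw [hcongr, latticeLaplacianZd_sub]
    linarith [hu x hx, hv x hx]
  -- `w ≤ 0` off the exterior: `= u - v ≤ 0` on the sphere, `= 0` inside
  have hoff : ∀ x ∉ {x | n < Site.supNorm x}, w x ≤ 0 := by
    intro x hx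
    simp only [Set.mem_setOf_eq, not_lt] at hx
    rcases hx.lt_or_eq with hlt | heq
    · have : w x = 0 := if_neg (by omega)
      rw [this]
    · rw [hw_eq x heq.ge]
      linarith [hbd x heq]
  -- `w → 0` at infinity (it agrees with `u - v` off the finite box)
  have hlim : Tendsto w cofinite (𝓝 0) := by
    have huv : Tendsto (fun x => u x - v x) cofinite (𝓝 0) := by simpa using hu0.sub hv0
    refine huv.congr' ?_
    rw [EventuallyEq, eventually_cofinite]
    refine (box d n).finite_toSet.subset fun x hx => ?_
    simp only [Set.mem_setOf_eq] at hx
    rw [Finset.mem_coe, mem_box_iff_supNorm_le]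
    by_contra hxn
    exact hx (hw_eq x (by omega)).symm
  intro x hx
  have key := hsub.le_of_tendsto hd hoff hlim x
  rw [hw_eq x hx] at key
  linarith

/-! ### The Messager–Miracle-Solé input on `ℤ³` -/

/-- **Messager–Miracle-Solé on the sup-norm sphere at `β_c(3)`**: `G(y) ≤ G(n e₁)` for
`‖y‖_∞ = n` (`twoPointPlus_le_axis_of_mem_sphere` with the tree's discharges
`messager_miracleSole_holds`, `twoPointPlus_reflection_invariant_holds`,
`twoPointPlus_perm_invariant_holds`). [folklore] -/
theorem criticalTwoPoint_three_le_axis {n : ℕ} {y : Site 3} (hy : Site.supNorm y = n) :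
    criticalTwoPoint 3 y ≤ criticalTwoPoint 3 (Pi.single 0 (n : ℤ)) := by
  have hMMS : ∀ {β : ℝ}, messager_miracleSole (d := 3) (β := β) := fun {β} =>
    messager_miracleSole_holds (d := 3) (β := β)
  have h := twoPointPlus_le_axis_of_mem_sphere hMMS twoPointPlus_reflection_invariant_holds
    twoPointPlus_perm_invariant_holds (criticalBeta_nonneg 3) (show 1 ≤ 3 by norm_num)
    (mem_sphere.2 hy)
  exact h

/-! ### The theorem -/

/-- **Perfect screening from non-saturation** (route `PerfectScreening`, item
`stmt-CriticalPhenomena-1346`, `ScreeningUpgrade`): if `G₀` (the Green function of the graph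
Laplacian of `ℤ³`, inline Brillouin-zone integral) has Coulomb asymptotics
`|G₀(x) - a/|x|₂| ≤ K/|x|₂²` with `a > 0`, the critical two-point function `G = ⟨σ₀σ_x⟩⁺_{β_c(3)}`
is lattice-subharmonic off the origin, and `liminf_n n·G(n e₁) = 0`, then `‖x‖·G(x) → 0` along
the cofinite filter of `ℤ³`. Proof: exterior maximum principle for `G - λG₀` outside a box on
whose boundary `G` is small (module docstring). [folklore] -/
theorem screeningUpgrade_proof :
    Summit.CriticalPhenomena.Ising3DConformalLimit.Theses.PerfectScreening.ScreeningUpgrade := by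
  unfold Summit.CriticalPhenomena.Ising3DConformalLimit.Theses.PerfectScreening.ScreeningUpgrade
  rintro ⟨a, K, ha, hGA⟩ hSubH hNonSat
  -- notation
  set G : Site 3 → ℝ := criticalTwoPoint 3 with hG
  set G₀ : Site 3 → ℝ := fun x => latticeGreen x / 2 with hG₀
  have h3 : (3 : ℕ) ≤ 3 := le_rfl
  -- the inline integral is `latticeGreen / 2`
  have hGA' : ∀ x : Site 3, x ≠ 0 →
      |G₀ x - a / Real.sqrt (∑ i, ((x i : ℤ) : ℝ) ^ 2)| ≤ K / (∑ i, ((x i : ℤ) : ℝ) ^ 2) := by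
    intro x hx
    have h := hGA x hx
    rwa [setIntegral_pi_cos_div_eq_half_latticeGreen x] at h
  -- inputs: `G ≥ 0`, `G → 0`, `G₀ → 0`, `Δ G ≥ 0` off `0`, `Δ G₀ ≤ 0`
  have hGnn : ∀ x, 0 ≤ G x := fun x => twoPointPlus_nonneg_of_gks (criticalBeta_nonneg 3) x
  have hGlim : Tendsto G cofinite (𝓝 0) := criticalTwoPoint_tendsto_zero_cofinite
  have hG₀lim : Tendsto G₀ cofinite (𝓝 0) := by
    simpa using (tendsto_latticeGreen_cofinite 3 h3).div_const 2
  have hΔG : ∀ x : Site 3, x ≠ 0 → 0 ≤ latticeLaplacianZd G x := by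
    intro x hx
    rw [latticeLaplacianZd_nonneg_iff]
    have h := hSubH x hx
    push_cast
    linarith
  have hΔG₀ : ∀ x : Site 3, latticeLaplacianZd G₀ x ≤ 0 := by
    intro x
    rw [hG₀, latticeLaplacianZd_half_latticeGreen 3 h3 x]
    split_ifs <;> norm_num
  -- the `ε`-argument
  rw [Metric.tendsto_nhds]
  intro ε hε
  set ε' : ℝ := ε / 16 with hε'
  have hε'0 : 0 < ε' := by positivity
  set R₀ : ℝ := 2 * max K 0 / a with hR₀
  -- a large non-saturated axial scale `n`
  obtain ⟨n, hn, hnG⟩ := Filter.frequently_atTop.1 (hNonSat ε' hε'0) (max 1 ⌈R₀⌉₊)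
  have hn1 : 1 ≤ n := le_of_max_le_left hn
  have hnR : R₀ ≤ (n : ℝ) :=
    (Nat.le_ceil R₀).trans (by exact_mod_cast le_of_max_le_right hn)
  have hn0 : (0 : ℝ) < n := by exact_mod_cast hn1
  -- the comparison function `λ G₀`, `λ = 4ε'/a`
  set lam : ℝ := 4 * ε' / a with hlam
  have hlam0 : 0 < lam := by positivity
  have hcomp : ∀ x : Site 3, n ≤ Site.supNorm x → G x ≤ lam * G₀ x := by
    refine le_on_exterior_of_le_on_sphere (d := 3) (by norm_num) (v := fun x => lam * G₀ x)
      (fun x hx => hΔG x ?_) (fun x _ => ?_) (fun y hy => ?_) hGlim ?_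
    · -- `x ≠ 0` on the exterior
      intro hx0
      rw [hx0, Site.supNorm_eq_zero_iff.2 rfl] at hx
      omega
    · -- `Δ (λ G₀) = λ Δ G₀ ≤ 0`
      rw [latticeLaplacianZd_const_mul]
      exact mul_nonpos_of_nonneg_of_nonpos hlam0.le (hΔG₀ x)
    · -- on the sphere: `G y ≤ G (n e₁) < ε'/n ≤ λ G₀ y`
      have hy0 : y ≠ 0 := by
        intro hy0
        rw [hy0, Site.supNorm_eq_zero_iff.2 rfl] at hy
        omega
      have hyR : R₀ ≤ (Site.supNorm y : ℝ) := by rw [hy]; exact hnR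
      have hlow := (green_window_of_asymptotics ha hGA' hy0 hyR).1
      rw [hy] at hlow
      have h1 : G y < ε' / n := by
        calc G y ≤ G (Pi.single 0 (n : ℤ)) := criticalTwoPoint_three_le_axis hy
          _ < ε' / n := by
            rw [lt_div_iff₀ hn0, mul_comm]
            exact hnG
      have h2 : ε' / n ≤ lam * G₀ y := by
        calc ε' / n = lam * (a / (4 * n)) := by
              rw [hlam]
              field_simp
          _ ≤ lam * G₀ y := mul_le_mul_of_nonneg_left hlow hlam0.le
      exact (h1.trans_le h2).le
    · simpa using hG₀lim.const_mul lam
  -- conclusion: `‖x‖ G x ≤ 8 ε' < ε` off the box `Λ_n`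
  rw [eventually_cofinite]
  refine (box 3 n).finite_toSet.subset fun x hx => ?_
  rw [Finset.mem_coe, mem_box_iff_supNorm_le]
  by_contra hxn
  apply hx
  have hnx : n ≤ Site.supNorm x := by omega
  have hx0 : x ≠ 0 := by
    intro hx0
    rw [hx0, Site.supNorm_eq_zero_iff.2 rfl] at hnx
    omega
  set N : ℝ := (Site.supNorm x : ℝ) with hN
  have hN0 : 0 < N := by
    rw [hN]; exact_mod_cast one_le_supNorm_of_ne_zero hx0
  have hxR : R₀ ≤ N := hnR.trans (by rw [hN]; exact_mod_cast hnx)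
  have hup := (green_window_of_asymptotics ha hGA' hx0 hxR).2
  have hGx : G x ≤ 8 * ε' / N := by
    calc G x ≤ lam * G₀ x := hcomp x hnx
      _ ≤ lam * (2 * a / N) := mul_le_mul_of_nonneg_left hup hlam0.le
      _ = 8 * ε' / N := by rw [hlam]; field_simp; ring
  rw [Real.dist_eq, sub_zero, Site.norm_eq_supNorm, ← hN,
    abs_of_nonneg (mul_nonneg hN0.le (hGnn x))]
  calc N * G x ≤ N * (8 * ε' / N) := mul_le_mul_of_nonneg_left hGx hN0.le
    _ = 8 * ε' := by field_simp
    _ < ε := by rw [hε']; linarith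

end Summit.CriticalPhenomena.Ising3DConformalLimit.Theorems
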